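import Literature.Barriers.CriticalPhenomena.GaussianDominationRouteLatticeConv
import Literature.Barriers.CriticalPhenomena.LaceExpansionFourier
import HarnessLib

/-!
# Parseval for two and three lattice functions: `Σ_x a(x) b(x) = ∫ â b̂ dk/(2π)^d` and
# `Σ_x a(x) (b ⋆ c)(x) = ∫ â b̂ ĉ dk/(2π)^d` (Heydenreich–van der Hofstad 2017, (5.1.6)–(5.1.8))

Sibling of `HvdHRandomWalk*.lean` (barrier catalogue `Literature/Barriers/CriticalPhenomena/`), a
leaf below the named fact `HvdH2017_prop83`. Lemmas 8.5–8.7 of Heydenreich–van der Hofstad move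
every `x`-space diagram to Fourier space before the bootstrap bounds `τ̂_p ≤ K Ĉ_λ` are used:
`Δ̃̃_p = (D⋆D⋆τ_p⋆τ_p⋆τ_p)(0) = ∫ D̂² τ̂_p³ dk/(2π)^d` (8.3.8), (8.3.13),
`Σ_x [1 - cos(k·x)] D(x) (D⋆D⋆τ_p)(x) = ∫ [D̂(l) - D̂^{cos}(k,l)] D̂(l)² τ̂_p(l) dl/(2π)^d`
(8.3.18), (8.3.21), (8.3.26), (8.3.28) — all instances of "the Fourier inversion theorem"
(5.1.6) with "`(f⋆g)^ = f̂ ĝ`" (5.1.7). The tree has inversion for ONE even `ℓ¹` function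
(`LaceExpansion.integral_cosFT_mul_cos`: `∫ f̂(k) cos(k·x) dk = (2π)^d f(x)`), Parseval for a
square (`LaceExpansion.integral_cosFT_sq`) and the cosine convolution theorem (`cosFT_conv`).
This file adds the bilinear and trilinear forms that the diagrams need, for the cube measure
`Slade2006Prop53.P d`:

* `integral_cosFT_mul_cosFT` — **`∫_{[-π,π]^d} â(k) b̂(k) dk = (2π)^d Σ_x a(x) b(x)`** for
  summable `a` and summable even `b` (term-by-term integration of `â = Σ_x cos(k·x) a(x)`
  against `b̂`, dominated by `Σ|a| · Σ|b| · (2π)^d`, then inversion for `b`);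
* `conv_neg_of_even`, `integral_cosFT_mul_cosFT_mul_cosFT` —
  **`∫ â b̂ ĉ dk = (2π)^d Σ_x a(x) (b ⋆ c)(x)`** for summable `a` and summable even `b`, `c`
  (`(b ⋆ c)(x) = Σ_u b(u) c(x - u)` is even and summable, and `(b⋆c)^ = b̂ ĉ`);
* `integrable_cosFT_mul_cosFT`, `abs_integral_cosFT_mul_le` — integrability, and the crude bound
  `|∫ â F dk| ≤ (Σ|a|) ∫ |F| dk` for a measurable multiplier `F` with `∫|F| < ∞` (how the
  bootstrap bounds `|τ̂| ≤ KĈ_λ`, `|½Δ_kτ̂| ≤ (K/2)Û_λ` enter).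

## References

* M. Heydenreich, R. van der Hofstad, *Progress in High-Dimensional Percolation and Random
  Graphs* (Springer 2017): (5.1.6)–(5.1.8), (1.2.16), Lemma 8.5 ((8.3.8), (8.3.13)), Lemma 8.6
  ((8.3.18), (8.3.21), (8.3.26), (8.3.28)), Lemma 8.7 ((8.3.32)).
-/

noncomputable section

open MeasureTheory Filter Real Literature.Probability.LatticeModels
open Literature.Probability.Percolation
open scoped ENNReal BigOperators

namespace Literature.Barriers.CriticalPhenomena

variable {d : ℕ}

open Slade2006Prop53

/-- For `a ∈ ℓ¹` and a bounded continuous `F`, `â F` is integrable on the cube. [folklore] -/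
theorem integrable_cosFT_mul {a : Site d → ℝ} (ha : Summable a) {F : (Fin d → ℝ) → ℝ}
    (hF : Continuous F) {C : ℝ} (hC : ∀ k, |F k| ≤ C) :
    Integrable (fun k => cosFT a k * F k) (P d) := by
  refine LaceExpansion.integrable_of_norm_le ((LaceExpansion.continuous_cosFT ha.abs).mul hF)
    (C := (∑' y, |a y|) * C) fun k => ?_
  rw [Real.norm_eq_abs, abs_mul]
  exact mul_le_mul (abs_cosFT_le ha k) (hC k) (abs_nonneg _) (tsum_nonneg fun _ => abs_nonneg _)

/-- `â b̂` is integrable on the cube for `a, b ∈ ℓ¹`. [folklore] -/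
theorem integrable_cosFT_mul_cosFT {a b : Site d → ℝ} (ha : Summable a) (hb : Summable b) :
    Integrable (fun k => cosFT a k * cosFT b k) (P d) :=
  integrable_cosFT_mul ha (LaceExpansion.continuous_cosFT hb.abs) fun k => abs_cosFT_le hb k

/-- **Parseval for two functions** ((5.1.6)–(5.1.7)): for summable `a` and summable even `b`,
`∫_{[-π,π]^d} â(k) b̂(k) dk = (2π)^d Σ_x a(x) b(x)`.
[cite: HeydenreichVanDerHofstad2017, (5.1.6)–(5.1.8)] -/
theorem integral_cosFT_mul_cosFT {a b : Site d → ℝ} (ha : Summable a) (hb : Summable b)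
    (hbe : ∀ x, b (-x) = b x) :
    ∫ k, cosFT a k * cosFT b k ∂P d = (2 * π) ^ d * ∑' x, a x * b x := by
  classical
  have hbe' : Function.Even b := fun x => hbe x
  set G : Site d → (Fin d → ℝ) → ℝ := fun x k => a x * (cosFT b k * Real.cos (kdot k x)) with hG
  have hexp : ∀ k, cosFT a k * cosFT b k = ∑' x, G x k := by
    intro k
    rw [cosFT, ← tsum_mul_right]
    exact tsum_congr fun x => by simp only [hG]; ring
  have hcont : Continuous (cosFT b) := LaceExpansion.continuous_cosFT hb.abs
  have hkdot : ∀ x : Site d, Continuous fun k : Fin d → ℝ => kdot k x := fun x => by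
    unfold kdot; fun_prop
  have hGm : ∀ x, AEStronglyMeasurable (G x) (P d) := fun x =>
    (continuous_const.mul (hcont.mul (Real.continuous_cos.comp (hkdot x)))).aestronglyMeasurable
  have hB : ∀ x k, ‖G x k‖ ≤ |a x| * ∑' y, |b y| := by
    intro x k
    rw [hG, Real.norm_eq_abs, abs_mul, abs_mul]
    refine mul_le_mul_of_nonneg_left ?_ (abs_nonneg _)
    calc |cosFT b k| * |Real.cos (kdot k x)| ≤ (∑' y, |b y|) * 1 :=
          mul_le_mul (abs_cosFT_le hb k) (Real.abs_cos_le_one _) (abs_nonneg _)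
            (tsum_nonneg fun _ => abs_nonneg _)
      _ = ∑' y, |b y| := mul_one _
  have hsum : ∑' x, ∫⁻ k, ‖G x k‖ₑ ∂P d ≠ ⊤ := by
    have h1 : ∀ x, ∫⁻ k, ‖G x k‖ₑ ∂P d ≤
        ENNReal.ofReal (|a x| * ∑' y, |b y|) * P d Set.univ := by
      intro x
      calc ∫⁻ k, ‖G x k‖ₑ ∂P d ≤ ∫⁻ _k, ENNReal.ofReal (|a x| * ∑' y, |b y|) ∂P d := by
            refine lintegral_mono fun k => ?_
            rw [← ofReal_norm]
            exact ENNReal.ofReal_le_ofReal (hB x k)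
        _ = _ := lintegral_const _
    refine ne_top_of_le_ne_top ?_ (ENNReal.tsum_le_tsum h1)
    rw [ENNReal.tsum_mul_right, ← ENNReal.ofReal_tsum_of_nonneg (fun x => by positivity)
      (ha.abs.mul_right _)]
    exact ENNReal.mul_ne_top ENNReal.ofReal_ne_top (measure_ne_top _ _)
  simp_rw [hexp]
  rw [integral_tsum hGm hsum]
  have hterm : ∀ x, ∫ k, G x k ∂P d = a x * ((2 * π) ^ d * b x) := by
    intro x
    simp only [hG]
    rw [integral_const_mul]
    congr 1
    have h := LaceExpansion.integral_cosFT_mul_cos hb.abs hbe' x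
    rwa [LaceExpansion.volume_restrict_cube_eq] at h
  simp_rw [hterm]
  rw [← tsum_mul_left]
  exact tsum_congr fun x => by ring

/-- The convolution of two even functions is even:
`(b ⋆ c)(-x) = Σ_u b(u) c(-x - u) = (b ⋆ c)(x)`. [folklore] -/
theorem conv_neg_of_even {b c : Site d → ℝ} (hbe : ∀ x, b (-x) = b x) (hce : ∀ x, c (-x) = c x)
    (x : Site d) : (∑' u, b u * c (-x - u)) = ∑' u, b u * c (x - u) := by
  rw [← (Equiv.neg (Site d)).tsum_eq]
  refine tsum_congr fun u => ?_
  simp only [Equiv.neg_apply, hbe]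
  rw [show -x - -u = -(x - u) by abel, hce]

/-- **Parseval for three functions** ((5.1.6)–(5.1.7), the shape of (8.3.13), (8.3.18), (8.3.21)):
for summable `a` and summable even `b`, `c`,
`∫_{[-π,π]^d} â(k) b̂(k) ĉ(k) dk = (2π)^d Σ_x a(x) (b ⋆ c)(x)` with
`(b ⋆ c)(x) = Σ_u b(u) c(x - u)`.
[cite: HeydenreichVanDerHofstad2017, (5.1.6)–(5.1.8) and (8.3.13)] -/
theorem integral_cosFT_mul_cosFT_mul_cosFT {a b c : Site d → ℝ} (ha : Summable a) (hb : Summable b)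
    (hc : Summable c) (hbe : ∀ x, b (-x) = b x) (hce : ∀ x, c (-x) = c x) :
    ∫ k, cosFT a k * cosFT b k * cosFT c k ∂P d =
      (2 * π) ^ d * ∑' x, a x * ∑' u, b u * c (x - u) := by
  have hconv : ∀ k, cosFT b k * cosFT c k = cosFT (fun x => ∑' u, b u * c (x - u)) k :=
    fun k => (cosFT_conv hb hc hce k).symm
  simp_rw [mul_assoc, hconv]
  exact integral_cosFT_mul_cosFT ha (summable_conv hb hc) (conv_neg_of_even hbe hce)

/-- **How the bootstrap bounds enter**: for `a ∈ ℓ¹` and a measurable multiplier `F` with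
`∫ |F| dk < ∞`, `|∫ â(k) F(k) dk| ≤ (Σ_x |a(x)|) ∫ |F(k)| dk` (`|â| ≤ Σ|a|` pointwise).
[cite: HeydenreichVanDerHofstad2017, (8.3.10) and (8.3.26)] -/
theorem abs_integral_cosFT_mul_le {a : Site d → ℝ} (ha : Summable a) {F : (Fin d → ℝ) → ℝ}
    (hF : Integrable F (P d)) :
    |∫ k, cosFT a k * F k ∂P d| ≤ (∑' x, |a x|) * ∫ k, |F k| ∂P d := by
  rw [← integral_const_mul]
  refine (abs_integral_le_integral_abs).trans (integral_mono_of_nonneg (ae_of_all _ fun _ =>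
    abs_nonneg _) (hF.abs.const_mul _) (ae_of_all _ fun k => ?_))
  dsimp only
  rw [abs_mul]
  exact mul_le_mul_of_nonneg_right (abs_cosFT_le ha k) (abs_nonneg _)

/-- A multiplier bound used under the integral: if `|F| ≤ G` pointwise with `G` integrable, then
`∫ |â F| dk ≤ (Σ_x |a(x)|) ∫ G dk` for `a ∈ ℓ¹`. [cite: HeydenreichVanDerHofstad2017, (8.3.10)] -/
theorem integral_abs_cosFT_mul_le {a : Site d → ℝ} (ha : Summable a) {F G : (Fin d → ℝ) → ℝ}
    (hFG : ∀ k, |F k| ≤ G k) (hG : Integrable G (P d)) :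
    ∫ k, |cosFT a k * F k| ∂P d ≤ (∑' x, |a x|) * ∫ k, G k ∂P d := by
  rw [← integral_const_mul]
  refine integral_mono_of_nonneg (ae_of_all _ fun _ => abs_nonneg _) (hG.const_mul _)
    (ae_of_all _ fun k => ?_)
  dsimp only
  rw [abs_mul]
  exact mul_le_mul (abs_cosFT_le ha k) (hFG k) (abs_nonneg _) (tsum_nonneg fun _ => abs_nonneg _)

end Literature.Barriers.CriticalPhenomena

end
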